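import Summits.Parity.GeneralizedHardyLittlewood.Theorems.LiouvilleShiftedTablesSieveToMAvgFunctional

/-!
# Sieve glue for `SieveToMAvg`, part 2: telescoping the logarithm out of the Heath-Brown pieces

Support file for item stmt-Parity-14274 (route `LiouvilleShiftedTables`).  The `j`-th Heath-Brown
piece is `hbPiece U j = μ_{≤U}^{⋆j} ⋆ ζ^{⋆(j−1)} ⋆ log` (`Literature.NumberTheory.Sieve.BFI.hbPiece`).
Writing `log v = ∑_{t<v} log((t+1)/t)` (`v ≥ 1`) gives, on `[1, T]`,

  `log = ∑_{t<T} ℓ_t · ζ_{>t}`,  `ℓ_t = log((t+1)/t) ≥ 0`,  `ζ_{>t}(v) = 1_{v>t}`,  `∑_{t<T} ℓ_t = log T`,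

hence `hbPiece U j = ∑_{t<T} ℓ_t · hbPieceT U j t` on `[1,T]` with the LOG-FREE pieces
`hbPieceT U j t = μ_{≤U}^{⋆j} ⋆ ζ^{⋆(j−1)} ⋆ ζ_{>t}` (all factors bounded by `1`, the last one the
indicator of `(t, ∞)`), and `TT(hbPiece) ≤ log T · max_t TT(hbPieceT t)` for the correlation
functional of part 1.  This replaces the partial summations of the classical treatment.
-/

namespace Summit.Parity.GeneralizedHardyLittlewood.Theorems.SieveToMAvg

open Finset Real
open scoped ArithmeticFunction.zeta
open Literature.NumberTheory.Sieve (moebiusTrunc)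
open Literature.NumberTheory.Sieve.BFI (hbPiece)

/-! ### The telescoping coefficients `ℓ_t` -/

/-- `ℓ_t = log((t+1)/t)` for `t ≥ 1`, and `ℓ_0 = 0`. [folklore] -/
noncomputable def ell (t : ℕ) : ℝ := if t = 0 then 0 else Real.log (((t : ℝ) + 1) / t)

/-- `ℓ_t ≥ 0`. [folklore] -/
theorem ell_nonneg (t : ℕ) : 0 ≤ ell t := by
  unfold ell
  split_ifs with ht
  · exact le_rfl
  · have ht0 : (0 : ℝ) < t := by exact_mod_cast Nat.pos_of_ne_zero ht
    exact Real.log_nonneg (by rw [le_div_iff₀ ht0]; linarith)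

/-- `∑_{t < v} ℓ_t = log v` for `v ≥ 1`. [folklore] -/
theorem sum_ell_range {v : ℕ} (hv : 1 ≤ v) : ∑ t ∈ range v, ell t = Real.log v := by
  induction v, hv using Nat.le_induction with
  | base => simp [ell]
  | succ v hv ih =>
    rw [Finset.sum_range_succ, ih]
    have hv0 : (0 : ℝ) < v := by exact_mod_cast hv
    have hne : (v : ℕ) ≠ 0 := by omega
    rw [ell, if_neg hne, Real.log_div (by positivity) hv0.ne']
    push_cast
    ring

/-- `∑_{t < T} ℓ_t ≤ log T` (equality for `T ≥ 1`, and `0 ≤ 0` for `T = 0`). [folklore] -/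
theorem sum_ell_range_le (T : ℕ) : ∑ t ∈ range T, ell t ≤ Real.log T := by
  rcases Nat.eq_zero_or_pos T with rfl | hT
  · simp
  · exact (sum_ell_range hT).le

/-! ### The indicator `ζ_{>t}` and the telescoped logarithm -/

/-- `ζ_{>t}(v) = 1` if `v > t`, else `0` (an arithmetic function: it vanishes at `0`). [folklore] -/
noncomputable def zetaGt (t : ℕ) : ArithmeticFunction ℝ where
  toFun n := if t < n then 1 else 0
  map_zero' := by simp

/-- Unfolding `zetaGt`. [folklore] -/
theorem zetaGt_apply (t n : ℕ) : zetaGt t n = if t < n then 1 else 0 := rfl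

/-- `|ζ_{>t}(n)| ≤ 1`. [folklore] -/
theorem abs_zetaGt_le_one (t n : ℕ) : |zetaGt t n| ≤ 1 := by
  rw [zetaGt_apply]; split_ifs <;> simp

/-- `0 ≤ ζ_{>t}(n)`. [folklore] -/
theorem zetaGt_nonneg (t n : ℕ) : 0 ≤ zetaGt t n := by
  rw [zetaGt_apply]; split_ifs <;> simp

/-- **Telescoped logarithm**: for `n ≤ T`, `log n = ∑_{t<T} ℓ_t ζ_{>t}(n)`. [folklore] -/
theorem log_apply_eq_sum {n T : ℕ} (hnT : n ≤ T) :
    (ArithmeticFunction.log : ArithmeticFunction ℝ) n = ∑ t ∈ range T, ell t * zetaGt t n := by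
  rcases Nat.eq_zero_or_pos n with rfl | hn
  · simp
  rw [ArithmeticFunction.log_apply, ← sum_ell_range hn]
  simp_rw [zetaGt_apply, mul_ite, mul_one, mul_zero]
  rw [← Finset.sum_filter]
  congr 1
  ext t
  simp only [Finset.mem_range, Finset.mem_filter]
  omega

/-- For any arithmetic function `F` and `n ≤ T`:
`(F ⋆ log)(n) = ∑_{t<T} ℓ_t (F ⋆ ζ_{>t})(n)`. [folklore] -/
theorem mul_log_apply_eq_sum (F : ArithmeticFunction ℝ) {n T : ℕ} (hnT : n ≤ T) :
    (F * ArithmeticFunction.log) n = ∑ t ∈ range T, ell t * (F * zetaGt t) n := by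
  simp only [ArithmeticFunction.mul_apply, Finset.mul_sum]
  rw [Finset.sum_comm]
  refine Finset.sum_congr rfl fun p hp => ?_
  have hp2 : p.2 ≤ T := by
    obtain ⟨hpn, hn0⟩ := Nat.mem_divisorsAntidiagonal.1 hp
    exact (Nat.le_of_dvd (Nat.pos_of_ne_zero hn0) ⟨p.1, by rw [mul_comm]; exact hpn.symm⟩).trans hnT
  rw [log_apply_eq_sum hp2, Finset.mul_sum]
  exact Finset.sum_congr rfl fun t _ => by ring

/-! ### The log-free Heath-Brown pieces -/

/-- The log-free `j`-th Heath-Brown piece with cut `t`: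
`hbPieceT U j t = μ_{≤U}^{⋆j} ⋆ ζ^{⋆(j−1)} ⋆ ζ_{>t}`. [folklore] -/
noncomputable def hbPieceT (U j t : ℕ) : ArithmeticFunction ℝ :=
  (moebiusTrunc U : ArithmeticFunction ℝ) ^ j * (ζ : ArithmeticFunction ℝ) ^ (j - 1) * zetaGt t

/-- **`hbPiece` telescoped**: for `n ≤ T`, `hbPiece U j (n) = ∑_{t<T} ℓ_t · hbPieceT U j t (n)`. [folklore] -/
theorem hbPiece_apply_eq_sum (U j : ℕ) {n T : ℕ} (hnT : n ≤ T) :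
    hbPiece U j n = ∑ t ∈ range T, ell t * hbPieceT U j t n := by
  unfold hbPiece hbPieceT
  exact mul_log_apply_eq_sum _ hnT

/-- **`TT` of a Heath-Brown piece through its log-free pieces**: if `⌊2x⌋ ≤ T` then
`TT(hbPiece U j) ≤ ∑_{t<T} ℓ_t · TT(hbPieceT U j t)`. [folklore] -/
theorem TT_hbPiece_le_sum (w : ℕ → ℝ) (h Q : ℕ) (x : ℝ) (U j : ℕ) {T : ℕ} (hT : ⌊2 * x⌋₊ ≤ T) :
    TT w h Q x (fun n => hbPiece U j n) ≤
      ∑ t ∈ range T, ell t * TT w h Q x (fun n => hbPieceT U j t n) := by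
  have hcongr : ∀ n ∈ Ioc ⌊x⌋₊ ⌊2 * x⌋₊,
      hbPiece U j n = ∑ t ∈ range T, ell t * hbPieceT U j t n := fun n hn =>
    hbPiece_apply_eq_sum U j ((Finset.mem_Ioc.1 hn).2.trans hT)
  rw [TT_congr w h Q x hcongr]
  refine (TT_sum_le w h Q x (range T) ell (fun t n => hbPieceT U j t n)).trans_eq ?_
  exact Finset.sum_congr rfl fun t _ => by rw [abs_of_nonneg (ell_nonneg t)]

/-- If every log-free piece has `TT ≤ B` (`B ≥ 0`) and `⌊2x⌋ ≤ T`, then `TT(hbPiece U j) ≤ B log T`. [folklore] -/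
theorem TT_hbPiece_le (w : ℕ → ℝ) (h Q : ℕ) (x : ℝ) (U j : ℕ) {T : ℕ} (hT : ⌊2 * x⌋₊ ≤ T)
    {B : ℝ} (hB : 0 ≤ B) (hpieces : ∀ t < T, TT w h Q x (fun n => hbPieceT U j t n) ≤ B) :
    TT w h Q x (fun n => hbPiece U j n) ≤ B * Real.log T := by
  refine (TT_hbPiece_le_sum w h Q x U j hT).trans ?_
  calc ∑ t ∈ range T, ell t * TT w h Q x (fun n => hbPieceT U j t n)
      ≤ ∑ t ∈ range T, ell t * B :=
        Finset.sum_le_sum fun t ht => mul_le_mul_of_nonneg_left (hpieces t (Finset.mem_range.1 ht)) (ell_nonneg t)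
    _ = B * ∑ t ∈ range T, ell t := by rw [← Finset.sum_mul, mul_comm]
    _ ≤ B * Real.log T := mul_le_mul_of_nonneg_left (sum_ell_range_le T) hB

end Summit.Parity.GeneralizedHardyLittlewood.Theorems.SieveToMAvg
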